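import Literature.NumberTheory.Automorphic.LocalComponentBJProofs
import Literature.NumberTheory.Automorphic.AshSmithTheoryHeckeLevelProofs
import Literature.NumberTheory.Automorphic.StrongMultiplicityOneSphericalProofs
import HarnessLib

/-!
# A spherical local component makes `π` unramified: the converse of
`hasLocalComponentAt_spherical_of_hasSatakeParamAt`

Topic `Literature/NumberTheory/Automorphic`, proof file (theorems only, no definition, no named
fact) next to `LocalComponentBJ` / `LocalComponentBJProofs` (Borel–Jacquet local components
`AutomorphicRepData.HasLocalComponentAt π v ρ` of `π = W / W'` and the discharged fact "`π` has a
Satake parameter at `v` ⇒ its irreducible smooth local component `π_v` is spherical") and to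
`AutomorphicRepsGLSatakeProofs` (`AutomorphicRepData.hasSatakeParamAt_of_fixed`: a
`K(𝔫)`-invariant form of `W ∖ W'`, `v ∤ 𝔫`, yields a Satake parameter at `v`, from the
discharged `Flath1979_heckeOperator_ofLocal_sub_smul_mem_holds`).

`AutomorphicRepData.isUnramifiedAt_of_hasLocalComponentAt_of_mem_fixedPoints`: if an irreducible
smooth local component `π_v` of `π = W / W'` at `v` has a non-zero `GL_n(𝒪_v)`-fixed vector, then
`π` is unramified at `v` (`IsUnramifiedAt`: it has a Satake parameter there).  This is the
remaining half of the unramified local–global dictionary "`π_v` spherical ⇔ `π` unramified at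
`v`" (Flath 1979, Thm. 3; Borel–Jacquet 1979, §4.6; Bump 1997, Thm. 3.3.3 and §3.4), used to turn
a LOCAL conclusion about `π_v` (e.g. from local–global compatibility
`WD(r|_{Γ_{K_v}})^{F-ss} ≅ rec_v(π_v)` at a place where `r` is unramified,
`HilbertModularLocalGlobalProofs`, plus the unramified clause of the local Langlands
correspondence) into the global `π.IsUnramifiedAt v`.

## Proof (averaging; no tensor product theorem)

Let `f : V → W` be the local component map (non-zero modulo `W'`, `GL_n(K_v)`-equivariant
modulo `W'`) and `x₀ ∈ V^{GL_n(𝒪_v)}`, `x₀ ≠ 0`; put `φ₀ = f x₀ ∈ W`.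
1. `φ₀ ∉ W'`: `V → W / W'` is injective (`π_v` irreducible, Schur), as in `LocalComponentBJProofs`.
2. `r(ι_v k) φ₀ ≡ φ₀ (mod W')` for `k ∈ GL_n(𝒪_v)` (equivariance and `ρ(k) x₀ = x₀`).
3. `φ₀` is invariant under some principal congruence subgroup `K(𝔪)`, `𝔪 ≠ 0`
   (`exists_isOpen_forall_rightTranslation_ofFinite_eq`, `exists_principalCongruenceLevel_subset`,
   as in `AutomorphicRepData.exists_principalCongruenceLevel_fixed`); write `𝔪 = v^e 𝔫` with
   `v ∤ 𝔫` (`WfDvdMonoid.max_power_factor`), so `|𝔪|_w = |𝔫|_w` for `w ≠ v`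
   (`idealRadius_pow_mul_of_ne` of `StrongMultiplicityOneSphericalProofs`, whose
   `exists_principalCongruenceLevel_not_dvd_mul_ofLocal_inv_mem` is the same level-stripping).
4. Average over `GL_n(𝒪_v) / N`, `N = GL_n(𝒪_v) ∩ (1 + 𝔪 M_n(𝒪_v))` (finite index: compact /
   open), whose image under `ι_v` lies in `K(𝔪)`: `φ₁ = ∑_{q} r(ι_v q̃) φ₀ ∈ W` is
   `ι_v(GL_n(𝒪_v))`-invariant (`subgroupQuotientSum_apply_mem_fixedPoints_of_forall`) and
   `φ₁ ≡ [GL_n(𝒪_v) : N] φ₀ ≢ 0 (mod W')` by 2.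
5. `φ₁` is `K(𝔫)`-invariant: `u ∈ K(𝔫)` factors as `u = ι_v(u_v) · c` with `u_v ∈ GL_n(𝒪_v)`
   (`|𝔫|_v = 1`) and `c = ι_v(u_v)⁻¹ u ∈ K(𝔪)` trivial at `v`, which commutes with
   `ι_v(GL_n(K_v))` (`GLn.ofLocal_mul_eq_mul_ofLocal_of_toLocal_eq_one`) and fixes `φ₀`.
6. `hasSatakeParamAt_of_fixed` at the level `K(𝔫)`, `v ∤ 𝔫`.

## References

* D. Flath, *Decomposition of representations into tensor products*, Corvallis 1979, Part 1,
  Thm. 3. [FlathCorvallis1979]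
* A. Borel, H. Jacquet, *Automorphic forms and automorphic representations*, Corvallis 1979,
  Part 1, §4.6. [BorelJacquetCorvallis1979]
* D. Bump, *Automorphic forms and representations* (1997), Thm. 3.3.3, §3.4. [Bump1997]
-/

open scoped MatrixGroups Matrix Classical
open NumberField NumberField.mixedEmbedding IsDedekindDomain

noncomputable section

namespace Literature.NumberTheory.Automorphic

namespace AutomorphicRepData

variable {n : ℕ} {K : Type} [Field K] [NumberField K] {hcpt : isCompact_glFiniteIntegralLevel n K}

/-- **A spherical local component makes `π` unramified at `v`** (Flath 1979, Thm. 3;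
Borel–Jacquet 1979, §4.6; the converse of `hasLocalComponentAt_spherical_of_hasSatakeParamAt`).
If `π = W / W'` has an irreducible smooth local component `π_v` at the finite place `v`
(`HasLocalComponentAt`) possessing a non-zero vector fixed by `GL_n(𝒪_v)`
(`valuedCongruenceSubgroup (Fin n) 1`), then `π` has a Satake parameter at `v`
(`IsUnramifiedAt`).  Proof by averaging a representative of the spherical line over
`GL_n(𝒪_v) / (GL_n(𝒪_v) ∩ K(𝔪)_v)` (module docstring), then `hasSatakeParamAt_of_fixed`.
[cite: FlathCorvallis1979, Thm. 3] [cite: BorelJacquetCorvallis1979, §4.6] -/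
theorem isUnramifiedAt_of_hasLocalComponentAt_of_mem_fixedPoints
    (π : AutomorphicRepData (AutomorphyDatum.gl n K hcpt)) (v : HeightOneSpectrum (𝓞 K))
    (πv : SmoothIrrep (GL (Fin n) (v.adicCompletion K))) (hloc : π.HasLocalComponentAt v πv.ρ)
    {x₀ : πv.V} (hx₀ : x₀ ≠ 0)
    (hK₀ : x₀ ∈ πv.ρ.fixedPoints
      (valuedCongruenceSubgroup (Fin n) (1 : WithZero (Multiplicative ℤ)))) :
    π.IsUnramifiedAt v := by
  classical
  obtain ⟨f, hfW, hfW', hf⟩ := hloc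
  -- notation: `R` right translation, `K₀ = GL_n(𝒪_v)`; the local embedding is `GLn.ofLocal n K v`
  set R : Representation ℂ (AdelicGroupData.gl n K).Adelic ((AdelicGroupData.gl n K).Adelic → ℂ) :=
    rightTranslation (AdelicGroupData.gl n K) with hR_def
  have hιmem : ∀ t, (GLn.ofLocal n K v) t ∈ (AutomorphyDatum.gl n K hcpt).finiteAdelic := fun t =>
    GLn.ofLocal_mem_range_ofFinite v t
  let K₀ : Subgroup (GL (Fin n) (v.adicCompletion K)) :=
    valuedCongruenceSubgroup (Fin n) (1 : WithZero (Multiplicative ℤ))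
  -- products are formed in `GL_n(𝔸_K)` (the level subgroups live there); `R` is multiplicative
  have hRmul : ∀ (g h : GL (Fin n) (AdeleRing (𝓞 K) K)) (ψ : (AdelicGroupData.gl n K).Adelic → ℂ),
      R (g * h) ψ = R g (R h ψ) := fun g h ψ => by
    have h1 : R (g * h) = R g * R h := map_mul R g h
    rw [h1]
    rfl
  -- the form `φ₀ = f x₀ ∈ W`
  set φ₀ : (AdelicGroupData.gl n K).Adelic → ℂ := f x₀ with hφ₀_def
  have hφ₀W : φ₀ ∈ π.W := hfW (LinearMap.mem_range_self f x₀)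
  -- Step 1: `φ₀ ∉ W'` — the map `V → W / W'` is injective (`π_v` irreducible)
  let ιf : GL (Fin n) (v.adicCompletion K) →* (AutomorphyDatum.gl n K hcpt).finiteAdelic :=
    (GLn.ofLocal n K v).codRestrict _ hιmem
  let σ : Representation ℂ (GL (Fin n) (v.adicCompletion K)) π.Quot := π.finiteRep.comp ιf
  have hσ_mk : ∀ (t : GL (Fin n) (v.adicCompletion K)) (ψ : π.W),
      σ t (Submodule.Quotient.mk ψ) = Submodule.Quotient.mk (p := π.kerQuot)
        ⟨rightTranslation (AdelicGroupData.gl n K) ((GLn.ofLocal n K v) t) ψ,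
          π.stable.finite_stable _ (hιmem t) ψ.2⟩ := fun _ _ => rfl
  let fW : πv.V →ₗ[ℂ] π.W :=
    LinearMap.codRestrict π.W f fun x => hfW (LinearMap.mem_range_self f x)
  let fQ : πv.V →ₗ[ℂ] π.Quot := π.mkQ ∘ₗ fW
  have hfQ_apply : ∀ x, fQ x = Submodule.Quotient.mk (p := π.kerQuot)
      ⟨f x, hfW (LinearMap.mem_range_self f x)⟩ := fun x => rfl
  have hfQ_equiv : ∀ (g : GL (Fin n) (v.adicCompletion K)) (x : πv.V),
      fQ (πv.ρ g x) = σ g (fQ x) := by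
    intro g x
    rw [hfQ_apply, hfQ_apply, hσ_mk, Submodule.Quotient.eq]
    exact hf g x
  have hfQ_ne : fQ ≠ 0 := by
    intro h0
    refine hfW' ?_
    rintro _ ⟨x, rfl⟩
    have hx : fQ x = 0 := by rw [h0, LinearMap.zero_apply]
    rw [hfQ_apply, Submodule.Quotient.mk_eq_zero] at hx
    exact hx
  have hfQ_inj : Function.Injective fQ := by
    rcases Representation.IsIrreducible.injective_or_eq_zero
        (fQ.intertwiningMap_of_isIntertwiningMap πv.ρ σ hfQ_equiv) with h | h
    · exact h
    · refine absurd (LinearMap.ext fun x => ?_) hfQ_ne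
      exact DFunLike.congr_fun h x
  have hφ₀W' : φ₀ ∉ π.W' := by
    intro h
    apply hx₀
    apply hfQ_inj
    rw [map_zero, hfQ_apply, Submodule.Quotient.mk_eq_zero]
    exact h
  -- Step 2: `φ₀ - r((GLn.ofLocal n K v) k) φ₀ ∈ W'` for `k ∈ GL_n(𝒪_v)` (sphericality of `x₀`)
  have hsph : ∀ k ∈ K₀, φ₀ - R ((GLn.ofLocal n K v) k) φ₀ ∈ π.W' := by
    intro k hk
    have h1 := hf k x₀
    rw [(πv.ρ.mem_fixedPoints K₀ x₀).1 hK₀ k hk] at h1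
    exact h1
  -- Step 3: a level `K(𝔪)` fixing `φ₀`
  obtain ⟨U₀, hU₀, hfixU⟩ :=
    exists_isOpen_forall_rightTranslation_ofFinite_eq (π.stable.le_automorphicForms hφ₀W)
  have hcont : Continuous (GLn.sndHom n K) := continuous_snd.generalLinearGroup_map
  have hnhds : (U₀ : Set (GL (Fin n) (FiniteAdeleRing (𝓞 K) K))) ∈ nhds (GLn.sndHom n K 1) := by
    rw [map_one]
    exact hU₀.mem_nhds U₀.one_mem
  obtain ⟨𝔪, h𝔪, hsub⟩ := exists_principalCongruenceLevel_subset n K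
    (hcont.continuousAt.preimage_mem_nhds hnhds)
  have hfix𝔪 : ∀ u ∈ principalCongruenceLevel n K 𝔪, R u φ₀ = φ₀ := by
    intro u hu
    have hu' : GLn.sndHom n K u ∈ U₀ := hsub hu
    rw [hR_def, ← GLn.ofFinite_sndHom_of_mem (principalCongruenceLevel_le n K 𝔪 hu)]
    exact hfixU _ hu'
  -- strip the `v`-part: `𝔪 = v^e 𝔫`, `v ∤ 𝔫`
  obtain ⟨e, 𝔫, hv𝔫, h𝔪eq⟩ := WfDvdMonoid.max_power_factor h𝔪 v.irreducible
  have h𝔫 : 𝔫 ≠ 0 := by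
    rintro rfl
    exact h𝔪 (by rw [h𝔪eq, mul_zero])
  have hrad : ∀ w : HeightOneSpectrum (𝓞 K), w ≠ v → idealRadius K w 𝔪 = idealRadius K w 𝔫 :=
    fun w hw => by rw [h𝔪eq]; exact idealRadius_pow_mul_of_ne K hw e h𝔫
  -- Step 4: the finite-index subgroup `N = GL_n(𝒪_v) ∩ K(𝔪)_v` of `K₀`
  have hc𝔪 : idealRadius K v 𝔪 ≠ 0 := by
    unfold idealRadius
    exact WithZero.coe_ne_zero
  let N : Subgroup K₀ :=
    (valuedCongruenceSubgroup (Fin n) (idealRadius K v 𝔪) :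
      Subgroup (GL (Fin n) (v.adicCompletion K))).subgroupOf K₀
  haveI hNfi : N.FiniteIndex := by
    haveI : CompactSpace K₀ :=
      isCompact_iff_compactSpace.mp (isCompact_valuedCongruenceSubgroup_one n K v)
    have hopen : IsOpen (N : Set K₀) :=
      Subgroup.subgroupOf_isOpen K₀ _ (isOpen_valuedCongruenceSubgroup_of_ne_zero (K := K) (v := v) n hc𝔪)
    haveI : Finite (K₀ ⧸ N) := Subgroup.quotient_finite_of_isOpen N hopen
    exact Subgroup.finiteIndex_of_finite_quotient
  have hιN : ∀ u : K₀, u ∈ N →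
      (GLn.ofLocal n K v) (u : GL (Fin n) (v.adicCompletion K)) ∈ principalCongruenceLevel n K 𝔪 := by
    intro u hu
    show GLn.ofLocal n K v (u : GL (Fin n) (v.adicCompletion K)) ∈ principalCongruenceLevel n K 𝔪
    rw [mem_principalCongruenceLevel_iff]
    refine ⟨isMaximalAt_glIntegralLevel n K v ⟨u, u.2, rfl⟩, fun w => ?_⟩
    by_cases hw : w = v
    · subst hw
      rw [GLn.toLocal_ofLocal]
      exact Subgroup.mem_subgroupOf.mp hu
    · rw [GLn.toLocal_ofLocal_of_ne hw]
      exact one_mem _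
  -- the average `φ₁`
  let ρ₀ : Representation ℂ (GL (Fin n) (v.adicCompletion K))
      ((AdelicGroupData.gl n K).Adelic → ℂ) := R.comp (GLn.ofLocal n K v)
  have hρ₀ : ∀ t ψ, ρ₀ t ψ = R ((GLn.ofLocal n K v) t) ψ := fun _ _ => rfl
  haveI : Fintype (K₀ ⧸ N) := Fintype.ofFinite _
  set φ₁ : (AdelicGroupData.gl n K).Adelic → ℂ :=
    (∑ᶠ q : K₀ ⧸ N, ρ₀ ((q.out : K₀) : GL (Fin n) (v.adicCompletion K))) φ₀ with hφ₁_def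
  have hφ₁K₀ : φ₁ ∈ ρ₀.fixedPoints K₀ :=
    subgroupQuotientSum_apply_mem_fixedPoints_of_forall ρ₀ K₀ N fun u hu => by
      rw [hρ₀]
      exact hfix𝔪 _ (hιN u hu)
  have hφ₁W : φ₁ ∈ π.W :=
    subgroupQuotientSum_apply_mem ρ₀ K₀ N
      (fun g _ ψ hψ => π.stable.finite_stable _ (hιmem g) hψ) hφ₀W
  have hφ₁eq : φ₁ = ∑ q : K₀ ⧸ N, R ((GLn.ofLocal n K v) ((q.out : K₀) : GL (Fin n) (v.adicCompletion K))) φ₀ := by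
    rw [hφ₁_def, finsum_eq_sum_of_fintype, LinearMap.sum_apply]
    rfl
  -- Step 4': `φ₁ ∉ W'`
  have hdiff : φ₁ - (Fintype.card (K₀ ⧸ N) : ℂ) • φ₀ ∈ π.W' := by
    have hrw : φ₁ - (Fintype.card (K₀ ⧸ N) : ℂ) • φ₀ =
        ∑ q : K₀ ⧸ N, (R ((GLn.ofLocal n K v) ((q.out : K₀) : GL (Fin n) (v.adicCompletion K))) φ₀ - φ₀) := by
      rw [Finset.sum_sub_distrib, Finset.sum_const, Finset.card_univ, ← Nat.cast_smul_eq_nsmul ℂ,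
        hφ₁eq]
    rw [hrw]
    refine π.W'.sum_mem fun q _ => ?_
    have h1 := π.W'.neg_mem (hsph _ (q.out : K₀).2)
    rwa [neg_sub] at h1
  have hφ₁W' : φ₁ ∉ π.W' := by
    intro h1
    have h2 : (Fintype.card (K₀ ⧸ N) : ℂ) • φ₀ ∈ π.W' := by
      have h3 := π.W'.sub_mem h1 hdiff
      rwa [sub_sub_cancel] at h3
    have hc : (Fintype.card (K₀ ⧸ N) : ℂ) ≠ 0 := Nat.cast_ne_zero.mpr Fintype.card_ne_zero
    exact hφ₀W' ((π.W'.smul_mem_iff hc).mp h2)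
  -- Step 5: `φ₁` is `K(𝔫)`-invariant
  have hev : ∀ g : GL (Fin n) (v.adicCompletion K),
      Matrix.GeneralLinearGroup.map (AdelicGroupData.adeleEval K v) (GLn.ofLocal n K v g) = g :=
    fun g => GLn.toLocal_ofLocal g
  have hev' : ∀ w : HeightOneSpectrum (𝓞 K), w ≠ v → ∀ g : GL (Fin n) (v.adicCompletion K),
      Matrix.GeneralLinearGroup.map (AdelicGroupData.adeleEval K w) (GLn.ofLocal n K v g) = 1 :=
    fun w hw g => GLn.toLocal_ofLocal_of_ne hw g
  have hfix𝔫 : ∀ u ∈ principalCongruenceLevel n K 𝔫, R u φ₁ = φ₁ := by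
    intro u hu
    rw [mem_principalCongruenceLevel_iff] at hu
    obtain ⟨huint, huloc⟩ := hu
    -- the `v`-component `t = u_v ∈ GL_n(𝒪_v)` (`|𝔫|_v = 1`) and the complement `c = ι_v(t)⁻¹ u`
    obtain ⟨t, ht⟩ : ∃ t : GL (Fin n) (v.adicCompletion K),
        Matrix.GeneralLinearGroup.map (AdelicGroupData.adeleEval K v) u = t := ⟨_, rfl⟩
    have htK₀ : t ∈ K₀ := by
      have h1 := huloc v
      rw [idealRadius_eq_one_of_not_dvd h𝔫 hv𝔫] at h1
      rw [← ht]
      exact h1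
    obtain ⟨c, hc⟩ : ∃ c : GL (Fin n) (AdeleRing (𝓞 K) K), (GLn.ofLocal n K v t)⁻¹ * u = c :=
      ⟨_, rfl⟩
    have hc1 : Matrix.GeneralLinearGroup.map (AdelicGroupData.adeleEval K v) c = 1 := by
      rw [← hc, map_mul, map_inv, hev, ht, inv_mul_cancel]
    have hcmem : c ∈ principalCongruenceLevel n K 𝔪 := by
      rw [mem_principalCongruenceLevel_iff]
      refine ⟨?_, fun w => ?_⟩
      · rw [← hc]
        exact (glIntegralLevel n K).mul_mem ((glIntegralLevel n K).inv_mem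
          (isMaximalAt_glIntegralLevel n K v ⟨t, htK₀, rfl⟩)) huint
      · show Matrix.GeneralLinearGroup.map (AdelicGroupData.adeleEval K w) c ∈ _
        by_cases hw : w = v
        · subst hw
          rw [hc1]
          exact one_mem _
        · rw [← hc, map_mul, map_inv, hev' w hw, inv_one, one_mul, hrad w hw]
          exact huloc w
    have hu_eq : u = GLn.ofLocal n K v t * c := by rw [← hc, mul_inv_cancel_left]
    -- `c` is trivial at `v`, hence commutes with `ι_v(GL_n(K_v))`, and it fixes `φ₀`
    have hcomm : ∀ (s : GL (Fin n) (v.adicCompletion K)) (ψ : (AdelicGroupData.gl n K).Adelic → ℂ),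
        R c (R (GLn.ofLocal n K v s) ψ) = R (GLn.ofLocal n K v s) (R c ψ) := by
      intro s ψ
      rw [← hRmul, ← hRmul]
      exact congrArg (fun g => R g ψ) (GLn.ofLocal_mul_eq_mul_ofLocal_of_toLocal_eq_one s hc1).symm
    have hRcφ₁ : R c φ₁ = φ₁ := by
      rw [hφ₁eq, map_sum]
      refine Finset.sum_congr rfl fun q _ => ?_
      rw [hcomm, hfix𝔪 c hcmem]
    rw [hu_eq, hRmul, hRcφ₁]
    exact (ρ₀.mem_fixedPoints K₀ φ₁).1 hφ₁K₀ t htK₀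
  -- Step 6: Satake parameter at the level `K(𝔫)`, `v ∤ 𝔫`
  obtain ⟨ϖ, hϖ⟩ := exists_valuation_eq_exp_neg_one K v
  exact hasSatakeParamAt_of_fixed π.Flath1979_heckeOperator_ofLocal_sub_smul_mem_holds h𝔫 hv𝔫 hϖ
    hφ₁W hφ₁W' hfix𝔫

/-- Variant with the spherical hypothesis in the spelling of
`hasLocalComponentAt_spherical_of_hasSatakeParamAt` (a non-zero vector fixed by the image of
`GL_n(𝒪_v)` under `GeneralLinearGroup.map`): together with that discharged fact, **`π` is
unramified at `v` iff its irreducible smooth local component at `v` is spherical**.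
[cite: FlathCorvallis1979, Thm. 3] [cite: BorelJacquetCorvallis1979, §4.6] -/
theorem isUnramifiedAt_of_hasLocalComponentAt_of_forall_apply_eq
    (π : AutomorphicRepData (AutomorphyDatum.gl n K hcpt)) (v : HeightOneSpectrum (𝓞 K))
    (πv : SmoothIrrep (GL (Fin n) (v.adicCompletion K))) (hloc : π.HasLocalComponentAt v πv.ρ)
    {x₀ : πv.V} (hx₀ : x₀ ≠ 0)
    (hfix : ∀ g ∈ (Matrix.GeneralLinearGroup.map
        ((v.adicCompletionIntegers K).subtype :
          v.adicCompletionIntegers K →+* v.adicCompletion K)).range, πv.ρ g x₀ = x₀) :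
    π.IsUnramifiedAt v := by
  refine π.isUnramifiedAt_of_hasLocalComponentAt_of_mem_fixedPoints v πv hloc hx₀ ?_
  rw [Representation.mem_fixedPoints]
  intro k hk
  obtain ⟨h₁, h₂, -⟩ := hk
  -- `k ∈ GL_n(𝒪_v)` comes from an invertible matrix over `𝒪_v`
  have hmem : ∀ i j, (k : Matrix (Fin n) (Fin n) (v.adicCompletion K)) i j ∈
      v.adicCompletionIntegers K := fun i j =>
    (HeightOneSpectrum.mem_adicCompletionIntegers (R := 𝓞 K) K v).mpr (h₁ i j)
  have hmem' : ∀ i j, ((k⁻¹ : GL (Fin n) (v.adicCompletion K)) :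
      Matrix (Fin n) (Fin n) (v.adicCompletion K)) i j ∈ v.adicCompletionIntegers K := fun i j =>
    (HeightOneSpectrum.mem_adicCompletionIntegers (R := 𝓞 K) K v).mpr (h₂ i j)
  let A : Matrix (Fin n) (Fin n) (v.adicCompletionIntegers K) := fun i j => ⟨_, hmem i j⟩
  let B : Matrix (Fin n) (Fin n) (v.adicCompletionIntegers K) := fun i j => ⟨_, hmem' i j⟩
  have hA : A.map (v.adicCompletionIntegers K).subtype =
      (k : Matrix (Fin n) (Fin n) (v.adicCompletion K)) := rfl
  have hB : B.map (v.adicCompletionIntegers K).subtype =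
      ((k⁻¹ : GL (Fin n) (v.adicCompletion K)) : Matrix (Fin n) (Fin n) (v.adicCompletion K)) := rfl
  have hinj : Function.Injective (fun M : Matrix (Fin n) (Fin n) (v.adicCompletionIntegers K) =>
      M.map (v.adicCompletionIntegers K).subtype) :=
    Matrix.map_injective Subtype.val_injective
  have hAB : A * B = 1 := by
    apply hinj
    change (A * B).map _ = (1 : Matrix _ _ _).map _
    rw [Matrix.map_mul, hA, hB, Matrix.map_one _ (map_zero _) (map_one _), ← Units.val_mul,
      mul_inv_cancel, Units.val_one]
  have hBA : B * A = 1 := by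
    apply hinj
    change (B * A).map _ = (1 : Matrix _ _ _).map _
    rw [Matrix.map_mul, hA, hB, Matrix.map_one _ (map_zero _) (map_one _), ← Units.val_mul,
      inv_mul_cancel, Units.val_one]
  let u : GL (Fin n) (v.adicCompletionIntegers K) := ⟨A, B, hAB, hBA⟩
  have hu : Matrix.GeneralLinearGroup.map (v.adicCompletionIntegers K).subtype u = k :=
    Units.ext hA
  rw [← hu]
  exact hfix _ ⟨u, rfl⟩

end AutomorphicRepData

end Literature.NumberTheory.Automorphic

end
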